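import Summits.QuantumFields.BalabanUV.Beta.GAN24.CombBorderWordTools
import Summits.QuantumFields.BalabanUV.Beta.GAN24.CombForcingSectorSplit
import Summits.QuantumFields.BalabanUV.Beta.GAN24.CombVHEWordsZero

/-!
# `BalabanUV.Beta.GAN24.CombBorderWordsZero` — binder row G-an2-4 ∕ (CONV-C), TRANSFER-III, the (III′) (C)-campaign's supplier `hB0`, **(27) AT THE COMB DATA** (leaf-01 g85 `README-g85`
# «LOCATED» (27)_comb): **THE `E′_c ⊗ VH′_{u′}` WORD AND ITS SWAP OVER TRANSPORTED TABLES — the transported Wilson table `𝒯(cE • wilsonA)` on the CELL bond, a transported border `𝒯S′`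
# (no ff block, block-covariant, multiplier legs coarse; at an1's record `S′ = c • symVhSAt ρ_c`) on the RESUMMED bond — VANISH IN THE ZERO MODE, at every kernel level `j`, for every
# transport root**: leaf-04 g66's (27) `VHWordsZeroCell` run on the transport-stripped word — the outer legs drop (A1), the middle kernel `Ψ̂X̃♮_jΨ̂ᵀ` has the fm face charges of `X̃♮_j`
# (D1 §1), the resummed multiplier current of the slot-transported border is the untransported one (A2 §1 ∕ D1 §2), and in the zero mode the left Wilson family loses its slot transport
# (D1 §3), after which leaf-04's flatness kill `sum_box_leftFamily_face_eq_zero` closes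
# (G-an2-4 CRUX TEAM (2), leaf prover `b2b-balaban-gan24-formalise-leaf-01`, gen 86; journal [LEAF01-G86-INTENT-3])

NOT IN PRINT; OUR BOOKKEEPING ([folklore] BY NAME over leaf-01 g86 A1 ∕ A2 ∕ D1, g85 F3 ∕ F6 ∕ F8, leaf-04 g66 `VHWordsZeroCell ∕ VHWordsZeroBorder`, an5's `TameKernelCalculus`; 0 `def`, 0 cited fact, 0 `def … : Prop`,
0 sorry).  HONEST FRAMING (cell contract, verbatim): «discharging `BetaPertH` makes Bałaban's UV stability UNCONDITIONAL — a real constructive-QFT result; it is NOT the continuum limit and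
NOT the Clay problem.»  HONEST DEPENDENCY (verbatim): «continuum YM on T⁴ ⇐ BetaPertH ∧ nine spine estimates (0/9 proved); BetaPertH ⇐ (D1) ∧ (D4) ∧ CAP+tail; G-an2-4 gates asym, D1 and NE2/3/4.»

## What is proved (generic `d`, `[NeZero Lc]`, `1 ≤ Lc`, in-block kernel root `toSite rb`, transport root `r ∈ box`, `𝒯S κ u := Ψ̂ᵀ∘slotPsiS r Lc S κ u∘Ψ̂`, every `j`, all units, any `cE`, all axes)
* §1 sockets: `wilson_inl_inr` (no field–multiplier block), `slotPsiS_inr_fst_supp ∕ slotPsiS_inr_snd_supp` (coarse multiplier legs pass the slot transport).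
* §2 **`sum_box_transported_wilson_border_word_eq_zero`** (DIRECT, zero mode):
  `Σ_{c ∈ box Lc} Σ'_{u′} Σ'_{(y,w)} 𝟙f(y_α)𝟙f(w_β)·((vertexOfK X̃♮_j Lc (unitS (𝒯(cE•wilsonA))) μ c ∘ X̃♮_j) ∘ vertexOfK X̃♮_j Lc (unitS (𝒯S′)) ν u′) y w (inl α)(inl β) = 0`;
  **`sum_box_transported_border_wilson_swap_word_eq_zero`** (SWAP, zero mode; border multiplier SECOND legs coarse).
* §3 AT THE COMB DATA (an1's border `c • symVhSAt ρ_c`, every `j`): **`sum_box_comb_wilson_symVhS_words_eq_zero`** — with B `CombVHEWordsZero`, F3, F5, 23 the ONLY level-`0` word of 33_0 still untyped is `E′ ⊗ E′`.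
WHAT THIS IS NOT: NO value; NOT `hB0`; at levels `≥ 1` the comb E-sector's own left face read is NOT treated; NEVER «G-an2-4 closed» as (CONV-C); NOT D1, NOT `BetaPertH`, NOT continuum, NOT Clay.
-/

noncomputable section

open Finset
open scoped BigOperators
open Literature.MathematicalPhysics.QuantumFieldTheory
open Literature.MathematicalPhysics.QuantumFieldTheory.Balaban1983to89
open Literature.MathematicalPhysics.QuantumFieldTheory.Balaban1983to89.Beta
open ExpKernelCalculus (Site MKer comp shiftK Decays BiLoc VertexFamily)
open BalabanStepJetsSucc (biLoc_comp_right)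
open AffineAveraging (box toSite)
open AveragingContours (off)
open AveragingContoursRooted (ctr ctrOff ctrOff_mem_box)
open OneStepResolventKernel (Fib LocStencil decays_mono biLoc_mono)
open OneStepKernelFamily (KInvStep vertexOfK vertexFamily_vertexOfK decays_KInvStep)
open StepJetData (wilsonA locStencil_wilsonA wilsonA_antisymm locStencil_smul)
open Summit.QuantumFields.BalabanUV.Beta.TameKernelCalculus (trK trK_apply trK_comp biLoc_trK Loc Spr Tame comp_assoc_tame comp_neg_left decays_trK)
open Summit.QuantumFields.BalabanUV.Beta.BorderedHessian (sgnK decays_sgnK)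
open Summit.QuantumFields.BalabanUV.Beta.AxialDressingRooted (coDressKBmAt decays_coDressKBmAt)
open Summit.QuantumFields.BalabanUV.Beta.HessKerDressedUnits (unitK unitS decays_unitK locStencil_unitS)
open Summit.QuantumFields.BalabanUV.Beta.SymAveragingHessianCounts (symVhSAt)
open Summit.QuantumFields.BalabanUV.Beta.SymCorrectorKernel (psiKS spr_psiKS)
open Summit.QuantumFields.BalabanUV.Beta.SymCorrectorFace (slotPsiS slotPsiS_shift)
open Summit.QuantumFields.BalabanUV.Beta.SymCorrectorSockets (locStencil_slotPsiS)
open Summit.QuantumFields.BalabanUV.Beta.GAN24.ExchangeSlotResum (face_weight_periodic tsum_twoFace_eq_trK)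
open Summit.QuantumFields.BalabanUV.Beta.GAN24.LayerCommutatorAntisymm (trK_unitK_coDress)
open Summit.QuantumFields.BalabanUV.Beta.GAN24.VHWordsZeroBorder (borderSlot_translate borderSlot_inr_fst_eq_zero borderSlot_inr_snd_eq_zero)
open Summit.QuantumFields.BalabanUV.Beta.GAN24.VHWordsZeroCell (tsum_ffLeft_profile_right_word_eq sum_fmCharge_mul sum_neg_fmCharge_mul sum_box_leftFamily_face_eq_zero)
open Summit.QuantumFields.BalabanUV.Beta.GAN24.CombTransportedBorder (pos_Lc slotPsiS_entry_eq_zero locStencil_symVhS symVhS_inl_inl symVhS_translate symVhS_inr_fst_eq_zero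
  symVhS_inr_snd_eq_zero)
open Summit.QuantumFields.BalabanUV.Beta.GAN24.CombSlotResumTransport (vertexOfK_unitS_transport_eq_conj)
open Summit.QuantumFields.BalabanUV.Beta.GAN24.CombForcingSectorSplit (E_zero_translate)
open Summit.QuantumFields.BalabanUV.Beta.GAN24.TransportedWordTools (exists_decays_sandwich spr_sandwich tsum_twoFace_conj_word_eq trK_vertexOfK_unitS_slotPsiS
  vertexOfK_unitS_slotPsiS_entry_eq_zero trK_sandwich_dressedStep sgnK_sandwich)
open Summit.QuantumFields.BalabanUV.Beta.GAN24.TransportedWordReduction (tsum_prod_weight_vertexOfK_dressedStep_slotPsiS)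
open Summit.QuantumFields.BalabanUV.Beta.GAN24.CombVHEWordsZero (wilson_antisymm)
open Summit.QuantumFields.BalabanUV.Beta.GAN24.CombBorderWordTools (hasSum_sandwich_dressedStep_fm_col hasSum_sandwich_sgnK_dressedStep_fm_col tsum_prod_weight_fst_vertexOfK_dressedStep_slotPsiS
  sum_box_leftFamily_slotPsiS_eq)

namespace Summit.QuantumFields.BalabanUV.Beta.GAN24.CombBorderWordsZero

variable {d : ℕ} {Lc : ℕ} [NeZero Lc] {rb r : Fin (d + 1) → ℕ}

/-! ## §1 Sockets -/

section Sockets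

omit [NeZero Lc] in
/-- [folklore] The Wilson table has no field–multiplier block (an3's `wilsonA`, by `rfl`). -/
theorem wilson_inl_inr (cE : ℝ) (κ' : Fin (d + 1)) (t x z : Site (d + 1)) (α' m : Fin (d + 1)) :
    (fun κ v => cE • wilsonA d κ v) κ' t x z (Sum.inl α') (Sum.inr m) = 0 := by
  simp only [Pi.smul_apply, smul_eq_mul]
  rw [show wilsonA d κ' t x z (Sum.inl α') (Sum.inr m) = 0 from rfl, mul_zero]

variable {S' : Fin (d + 1) → Site (d + 1) → MKer (d + 1) (Fib d)}

omit [NeZero Lc] in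
/-- [folklore] **COARSE MULTIPLIER FIRST LEGS PASS THE SLOT TRANSPORT** (an entrywise vanishing at fixed legs, `CombTransportedBorder.slotPsiS_entry_eq_zero`). -/
theorem slotPsiS_inr_fst_supp (r : Fin (d + 1) → ℕ)
    (hS'supp : ∀ (κ : Fin (d + 1)) (t z w : Site (d + 1)) (m : Fin (d + 1)) (b : Fib d), off Lc z ≠ 0 → S' κ t z w (Sum.inr m) b = 0)
    (κ : Fin (d + 1)) (t z w : Site (d + 1)) (m : Fin (d + 1)) (b : Fib d) (hz : off Lc z ≠ 0) : slotPsiS r Lc S' κ t z w (Sum.inr m) b = 0 :=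
  slotPsiS_entry_eq_zero r (fun κ' u' => hS'supp κ' u' z w m b hz) κ t

omit [NeZero Lc] in
/-- [folklore] … and so do coarse multiplier SECOND legs. -/
theorem slotPsiS_inr_snd_supp (r : Fin (d + 1) → ℕ)
    (hS'supp : ∀ (κ : Fin (d + 1)) (t z w : Site (d + 1)) (a : Fib d) (m : Fin (d + 1)), off Lc w ≠ 0 → S' κ t z w a (Sum.inr m) = 0)
    (κ : Fin (d + 1)) (t z w : Site (d + 1)) (a : Fib d) (m : Fin (d + 1)) (hw : off Lc w ≠ 0) : slotPsiS r Lc S' κ t z w a (Sum.inr m) = 0 :=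
  slotPsiS_entry_eq_zero r (fun κ' u' => hS'supp κ' u' z w a m hw) κ t

end Sockets

/-! ## §2 The two words over transported tables, in the zero mode -/

section Words

variable {S' : Fin (d + 1) → Site (d + 1) → MKer (d + 1) (Fib d)} {Cs δs : ℝ} {μ ν α β : Fin (d + 1)}

/-- NOT IN PRINT; OUR BOOKKEEPING ([folklore]; (27) AT THE COMB DATA, THE DIRECT WORD, ZERO MODE).  Every kernel level `j`, in-block kernel root `toSite rb`, ANY transport root `r ∈ box`, `1 ≤ Lc`,
all units, any `cE`, all axes; `S′` local, no ff block, block-covariant, multiplier FIRST legs coarse: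
`Σ_{c ∈ box Lc} Σ'_{u′} Σ'_{(y,w)} 𝟙f(y_α)𝟙f(w_β)·((vertexOfK X̃♮_j Lc (unitS (𝒯(cE•wilsonA))) μ c ∘ X̃♮_j) ∘ vertexOfK X̃♮_j Lc (unitS (𝒯S′)) ν u′) y w (inl α)(inl β) = 0`.
ROUTE: per bond F8 §1 + A1 `tsum_twoFace_conj_word_eq` (outer legs drop) ⨾ leaf-04 `tsum_ffLeft_profile_right_word_eq` with `P :=` the Wilson vertex over `unitS (slotPsiS (cE•wilsonA))`, `Y := Ψ̂X̃♮_jΨ̂ᵀ`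
(fm charges D1 §1), `Q :=` the border vertex over `unitS (slotPsiS S′)` ⨾ its resummed multiplier current untransported (A2 §1) ⨾ `sum_fmCharge_mul` ⨾ in the cell sum D1 §3
`sum_box_leftFamily_slotPsiS_eq` ⨾ leaf-04 `sum_box_leftFamily_face_eq_zero`. -/
theorem sum_box_transported_wilson_border_word_eq_zero (hLc : 1 ≤ Lc) (hrb : rb ∈ box (d + 1) Lc) (hr : r ∈ box (d + 1) Lc) (sf sm cE : ℝ) (j : ℕ)
    (hS' : LocStencil S' Cs δs) (hδs : 0 < δs) (hS'ff : ∀ (κ' : Fin (d + 1)) (t x z : Site (d + 1)) (α' a : Fin (d + 1)), S' κ' t x z (Sum.inl α') (Sum.inl a) = 0)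
    (hS'cov : ∀ (κ : Fin (d + 1)) (u t : Site (d + 1)), S' κ (u + (Lc : ℤ) • t) = shiftK (-((Lc : ℤ) • t)) (S' κ u))
    (hS'supp : ∀ (κ : Fin (d + 1)) (t z w : Site (d + 1)) (m : Fin (d + 1)) (b : Fib d), off Lc z ≠ 0 → S' κ t z w (Sum.inr m) b = 0) :
    ∑ c ∈ box (d + 1) Lc, ∑' u' : Site (d + 1), ∑' yw : Site (d + 1) × Site (d + 1), (if yw.1 α % (Lc : ℤ) = (Lc : ℤ) - 1 then (1 : ℝ) else 0) * (if yw.2 β % (Lc : ℤ) = (Lc : ℤ) - 1 then (1 : ℝ) else 0) *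
        comp (comp (vertexOfK (unitK sf sm (coDressKBmAt (toSite rb) Lc (KInvStep (d := d) Lc j))) Lc
            (unitS sf sm (fun κ u => comp (comp (trK (psiKS r Lc)) (slotPsiS r Lc (fun κ v => cE • wilsonA d κ v) κ u)) (psiKS r Lc))) μ (toSite c))
          (unitK sf sm (coDressKBmAt (toSite rb) Lc (KInvStep (d := d) Lc j))))
          (vertexOfK (unitK sf sm (coDressKBmAt (toSite rb) Lc (KInvStep (d := d) Lc j))) Lc
            (unitS sf sm (fun κ u => comp (comp (trK (psiKS r Lc)) (slotPsiS r Lc S' κ u)) (psiKS r Lc))) ν u') yw.1 yw.2 (Sum.inl α) (Sum.inl β) = 0 := by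
  classical
  have hLc0 : 0 < Lc := hLc
  set X := unitK sf sm (coDressKBmAt (toSite rb) Lc (KInvStep (d := d) Lc j)) with hX
  -- common-rate data
  obtain ⟨δK, CK, hδK, hCK, hXd⟩ := decays_coDressKBmAt hLc hrb (decays_KInvStep (d := d) (Lc := Lc) j)
  have hXu : Decays X (max |sf| |sm| * CK * max |sf| |sm|) δK := decays_unitK (sf := sf) (sm := sm) hXd
  have hCX : 0 ≤ max |sf| |sm| * CK * max |sf| |sm| := by positivity
  have hCs : 0 ≤ Cs := (hS' 0 0).nonneg (Sum.inl 0)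
  set δ₁ : ℝ := min δK δs with hδ₁
  have hδ₁0 : 0 < δ₁ := lt_min hδK hδs
  have hX1 : Decays X (max |sf| |sm| * CK * max |sf| |sm|) δ₁ := decays_mono hXu hCX le_rfl (min_le_left _ _)
  have hXspr : Spr X := ⟨_, _, hδ₁0, hX1⟩
  have hW1 := locStencil_smul cE (locStencil_wilsonA (d := d) hδ₁0.le)
  have hS1 : LocStencil S' Cs δ₁ := fun κ' u => biLoc_mono (hS' κ' u) hCs (min_le_right _ _)
  have hWs := locStencil_slotPsiS (d := d) hLc0 r hW1 hδ₁0.le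
  have hSs := locStencil_slotPsiS (d := d) hLc0 r hS1 hδ₁0.le
  have hPf := vertexFamily_vertexOfK (N := Lc) hX1 hCX (locStencil_unitS (sf := sf) (sm := sm) hWs) hδ₁0 le_rfl
  have hQf := vertexFamily_vertexOfK (N := Lc) hX1 hCX (locStencil_unitS (sf := sf) (sm := sm) hSs) hδ₁0 le_rfl
  have hCp := (hPf μ 0).nonneg (Sum.inl 0)
  have hCq := (hQf μ 0).nonneg (Sum.inl 0)
  have h₁ : ∀ y : Site (d + 1), |(if y α % (Lc : ℤ) = (Lc : ℤ) - 1 then (1 : ℝ) else 0)| ≤ 1 := fun y => by split_ifs <;> simp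
  have h₂ : ∀ w : Site (d + 1), |(if w β % (Lc : ℤ) = (Lc : ℤ) - 1 then (1 : ℝ) else 0)| ≤ 1 := fun w => by split_ifs <;> simp
  have hSscov : ∀ (κ : Fin (d + 1)) (u t : Site (d + 1)), slotPsiS r Lc S' κ (u + (Lc : ℤ) • t) = shiftK (-((Lc : ℤ) • t)) (slotPsiS r Lc S' κ u) :=
    fun κ u t => slotPsiS_shift hLc0 r hS'cov κ u t
  -- the sandwich middle kernel
  obtain ⟨CY, hCY, hY⟩ := exists_decays_sandwich hLc0 hr hX1 hδ₁0
  -- per cell bond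
  have hval : ∀ c : Site (d + 1), (∑' u' : Site (d + 1), ∑' yw : Site (d + 1) × Site (d + 1), (if yw.1 α % (Lc : ℤ) = (Lc : ℤ) - 1 then (1 : ℝ) else 0) * (if yw.2 β % (Lc : ℤ) = (Lc : ℤ) - 1 then (1 : ℝ) else 0) *
        comp (comp (vertexOfK X Lc (unitS sf sm (fun κ u => comp (comp (trK (psiKS r Lc)) (slotPsiS r Lc (fun κ v => cE • wilsonA d κ v) κ u)) (psiKS r Lc))) μ c) X)
          (vertexOfK X Lc (unitS sf sm (fun κ u => comp (comp (trK (psiKS r Lc)) (slotPsiS r Lc S' κ u)) (psiKS r Lc))) ν u') yw.1 yw.2 (Sum.inl α) (Sum.inl β)) =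
      ∑' y₁ : Site (d + 1), ∑ a : Fin (d + 1), (∑' y : Site (d + 1), (if y α % (Lc : ℤ) = (Lc : ℤ) - 1 then (1 : ℝ) else 0) *
          vertexOfK X Lc (unitS sf sm (slotPsiS r Lc (fun κ v => cE • wilsonA d κ v))) μ c y y₁ (Sum.inl α) (Sum.inl a)) *
        ((if y₁ a % (Lc : ℤ) = (Lc : ℤ) - 1 then (1 : ℝ) else 0) * (((Lc : ℝ) * (sm * sf)) * ((((Lc ^ (j + 1) : ℕ) : ℝ)) ^ (d + 1 + 1))⁻¹ *
          (∑' uw : Site (d + 1) × Site (d + 1), (if uw.2 β % (Lc : ℤ) = (Lc : ℤ) - 1 then (1 : ℝ) else 0) * vertexOfK X Lc (unitS sf sm S') ν uw.1 0 uw.2 (Sum.inr a) (Sum.inl β)))) := by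
    intro c
    -- (i) transports out of both vertices, outer legs drop
    have e : ∀ u' : Site (d + 1), (∑' yw : Site (d + 1) × Site (d + 1), (if yw.1 α % (Lc : ℤ) = (Lc : ℤ) - 1 then (1 : ℝ) else 0) * (if yw.2 β % (Lc : ℤ) = (Lc : ℤ) - 1 then (1 : ℝ) else 0) *
          comp (comp (vertexOfK X Lc (unitS sf sm (fun κ u => comp (comp (trK (psiKS r Lc)) (slotPsiS r Lc (fun κ v => cE • wilsonA d κ v) κ u)) (psiKS r Lc))) μ c) X)
            (vertexOfK X Lc (unitS sf sm (fun κ u => comp (comp (trK (psiKS r Lc)) (slotPsiS r Lc S' κ u)) (psiKS r Lc))) ν u') yw.1 yw.2 (Sum.inl α) (Sum.inl β)) =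
        ∑' yw : Site (d + 1) × Site (d + 1), (if yw.1 α % (Lc : ℤ) = (Lc : ℤ) - 1 then (1 : ℝ) else 0) * (if yw.2 β % (Lc : ℤ) = (Lc : ℤ) - 1 then (1 : ℝ) else 0) *
          comp (comp (vertexOfK X Lc (unitS sf sm (slotPsiS r Lc (fun κ v => cE • wilsonA d κ v))) μ c) (comp (comp (psiKS r Lc) X) (trK (psiKS r Lc))))
            (vertexOfK X Lc (unitS sf sm (slotPsiS r Lc S')) ν u') yw.1 yw.2 (Sum.inl α) (Sum.inl β) := by
      intro u'
      rw [vertexOfK_unitS_transport_eq_conj hLc0 hr hXspr sf sm hW1 hδ₁0 μ c, vertexOfK_unitS_transport_eq_conj hLc0 hr hXspr sf sm hS1 hδ₁0 ν u']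
      exact tsum_twoFace_conj_word_eq hLc0 hr (hPf μ c) (half_pos hδ₁0) (hQf ν u') (half_pos hδ₁0) hX1 hδ₁0 h₁ (fun y s => face_weight_periodic Lc α y s) h₂
        (fun w s => face_weight_periodic Lc β w s) _ _
    rw [tsum_congr e]
    -- (ii) leaf-04's reduction with the sandwich middle kernel and the slot-transported border
    have hP8 : BiLoc (vertexOfK X Lc (unitS sf sm (slotPsiS r Lc (fun κ v => cE • wilsonA d κ v))) μ c) ((Lc : ℤ) • c) ((Lc : ℤ) • c) _ (δ₁ / 8) := biLoc_mono (hPf μ c) hCp (by linarith)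
    have hY4 : Decays (comp (comp (psiKS r Lc) X) (trK (psiKS r Lc))) CY (δ₁ / 4) := hY
    have hA := biLoc_comp_right (biLoc_mono (hPf μ c) hCp (show δ₁ / 4 ≤ δ₁ / 2 by linarith)) hY4 (show (0 : ℝ) ≤ δ₁ / 8 by positivity) (by linarith)
    rw [tsum_ffLeft_profile_right_word_eq (N := Lc) (α := α) (β := β) (ρ₁ := fun y : Site (d + 1) => (if y α % (Lc : ℤ) = (Lc : ℤ) - 1 then (1 : ℝ) else 0))
      (ρ₂ := fun w : Site (d + 1) => (if w β % (Lc : ℤ) = (Lc : ℤ) - 1 then (1 : ℝ) else 0)) (show (0 : ℝ) < δ₁ / 8 by positivity) hP8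
      (fun y z α' m => vertexOfK_unitS_slotPsiS_entry_eq_zero r X Lc sf sm (fun κ t x z' => wilson_inl_inr cE κ t x z' α' m) μ c y z)
      (decays_mono hY4 hCY le_rfl (by linarith))
      (fun y₁ a m => by rw [hX]; exact hasSum_sandwich_dressedStep_fm_col hLc0 hr hLc hrb sf sm j y₁ a m) hA (fun u => biLoc_mono (hQf ν u) hCq (by linarith))
      (fun u s => by rw [hX]; exact borderSlot_translate (r := rb) hLc sf sm j hSscov ν u s)
      (fun u z w b' b => vertexOfK_unitS_slotPsiS_entry_eq_zero r X Lc sf sm (fun κ t x z' => hS'ff κ t x z' b' b) ν u z w)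
      (fun u z w m b hz => borderSlot_inr_fst_eq_zero X sf sm (slotPsiS_inr_fst_supp (Lc := Lc) r hS'supp) ν u z w m b hz) h₁ h₂ (fun w s => face_weight_periodic Lc β w s)]
    refine tsum_congr fun y₁ => Finset.sum_congr rfl fun a _ => ?_
    congr 1
    -- (iii) the resummed multiplier current of the slot-transported border is the untransported one
    have et : ∀ m : Fin (d + 1), (∑' uw : Site (d + 1) × Site (d + 1), (if uw.2 β % (Lc : ℤ) = (Lc : ℤ) - 1 then (1 : ℝ) else 0) * vertexOfK X Lc (unitS sf sm (slotPsiS r Lc S')) ν uw.1 0 uw.2 (Sum.inr m) (Sum.inl β))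
        = ∑' uw : Site (d + 1) × Site (d + 1), (if uw.2 β % (Lc : ℤ) = (Lc : ℤ) - 1 then (1 : ℝ) else 0) * vertexOfK X Lc (unitS sf sm S') ν uw.1 0 uw.2 (Sum.inr m) (Sum.inl β) := by
      intro m
      rw [hX]
      exact tsum_prod_weight_vertexOfK_dressedStep_slotPsiS hLc hrb sf sm j ν r hS' hδs h₂ 0 (Sum.inr m) (Sum.inl β)
    simp only [et]
    exact sum_fmCharge_mul (d := d) Lc sf sm (((((Lc ^ (j + 1) : ℕ) : ℝ)) ^ (d + 1 + 1))⁻¹)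
      (fun m => ∑' uw : Site (d + 1) × Site (d + 1), (if uw.2 β % (Lc : ℤ) = (Lc : ℤ) - 1 then (1 : ℝ) else 0) * vertexOfK X Lc (unitS sf sm S') ν uw.1 0 uw.2 (Sum.inr m) (Sum.inl β)) y₁ a
  simp only [hX] at hval
  rw [Finset.sum_congr rfl fun c _ => hval (toSite c)]
  -- (iv) the cell sum: drop the slot transport of the left family, then leaf-04's flatness kill
  have hAb : ∀ (a : Fin (d + 1)) (y : Site (d + 1)), |(if y a % (Lc : ℤ) = (Lc : ℤ) - 1 then (1 : ℝ) else 0) * (((Lc : ℝ) * (sm * sf)) * ((((Lc ^ (j + 1) : ℕ) : ℝ)) ^ (d + 1 + 1))⁻¹ *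
      (∑' uw : Site (d + 1) × Site (d + 1), (if uw.2 β % (Lc : ℤ) = (Lc : ℤ) - 1 then (1 : ℝ) else 0) *
        vertexOfK (unitK sf sm (coDressKBmAt (toSite rb) Lc (KInvStep (d := d) Lc j))) Lc (unitS sf sm S') ν uw.1 0 uw.2 (Sum.inr a) (Sum.inl β)))| ≤
      ∑ a' : Fin (d + 1), |((Lc : ℝ) * (sm * sf)) * ((((Lc ^ (j + 1) : ℕ) : ℝ)) ^ (d + 1 + 1))⁻¹ *
        (∑' uw : Site (d + 1) × Site (d + 1), (if uw.2 β % (Lc : ℤ) = (Lc : ℤ) - 1 then (1 : ℝ) else 0) *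
          vertexOfK (unitK sf sm (coDressKBmAt (toSite rb) Lc (KInvStep (d := d) Lc j))) Lc (unitS sf sm S') ν uw.1 0 uw.2 (Sum.inr a') (Sum.inl β))| := by
    intro a y
    have h1 : |(if y a % (Lc : ℤ) = (Lc : ℤ) - 1 then (1 : ℝ) else 0) * (((Lc : ℝ) * (sm * sf)) * ((((Lc ^ (j + 1) : ℕ) : ℝ)) ^ (d + 1 + 1))⁻¹ *
        (∑' uw : Site (d + 1) × Site (d + 1), (if uw.2 β % (Lc : ℤ) = (Lc : ℤ) - 1 then (1 : ℝ) else 0) *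
          vertexOfK (unitK sf sm (coDressKBmAt (toSite rb) Lc (KInvStep (d := d) Lc j))) Lc (unitS sf sm S') ν uw.1 0 uw.2 (Sum.inr a) (Sum.inl β)))| ≤
        |((Lc : ℝ) * (sm * sf)) * ((((Lc ^ (j + 1) : ℕ) : ℝ)) ^ (d + 1 + 1))⁻¹ *
          (∑' uw : Site (d + 1) × Site (d + 1), (if uw.2 β % (Lc : ℤ) = (Lc : ℤ) - 1 then (1 : ℝ) else 0) *
            vertexOfK (unitK sf sm (coDressKBmAt (toSite rb) Lc (KInvStep (d := d) Lc j))) Lc (unitS sf sm S') ν uw.1 0 uw.2 (Sum.inr a) (Sum.inl β))| := by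
      rw [abs_mul]; exact mul_le_of_le_one_left (abs_nonneg _) (by split_ifs <;> simp)
    exact h1.trans (Finset.single_le_sum (f := fun a' => |((Lc : ℝ) * (sm * sf)) * ((((Lc ^ (j + 1) : ℕ) : ℝ)) ^ (d + 1 + 1))⁻¹ *
        (∑' uw : Site (d + 1) × Site (d + 1), (if uw.2 β % (Lc : ℤ) = (Lc : ℤ) - 1 then (1 : ℝ) else 0) *
          vertexOfK (unitK sf sm (coDressKBmAt (toSite rb) Lc (KInvStep (d := d) Lc j))) Lc (unitS sf sm S') ν uw.1 0 uw.2 (Sum.inr a') (Sum.inl β))|)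
      (fun _ _ => abs_nonneg _) (Finset.mem_univ a))
  have hAp : ∀ (a : Fin (d + 1)) (y s : Site (d + 1)), (if (y + (Lc : ℤ) • s) a % (Lc : ℤ) = (Lc : ℤ) - 1 then (1 : ℝ) else 0) * (((Lc : ℝ) * (sm * sf)) * ((((Lc ^ (j + 1) : ℕ) : ℝ)) ^ (d + 1 + 1))⁻¹ *
      (∑' uw : Site (d + 1) × Site (d + 1), (if uw.2 β % (Lc : ℤ) = (Lc : ℤ) - 1 then (1 : ℝ) else 0) *
        vertexOfK (unitK sf sm (coDressKBmAt (toSite rb) Lc (KInvStep (d := d) Lc j))) Lc (unitS sf sm S') ν uw.1 0 uw.2 (Sum.inr a) (Sum.inl β))) =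
      (if y a % (Lc : ℤ) = (Lc : ℤ) - 1 then (1 : ℝ) else 0) * (((Lc : ℝ) * (sm * sf)) * ((((Lc ^ (j + 1) : ℕ) : ℝ)) ^ (d + 1 + 1))⁻¹ *
      (∑' uw : Site (d + 1) × Site (d + 1), (if uw.2 β % (Lc : ℤ) = (Lc : ℤ) - 1 then (1 : ℝ) else 0) *
        vertexOfK (unitK sf sm (coDressKBmAt (toSite rb) Lc (KInvStep (d := d) Lc j))) Lc (unitS sf sm S') ν uw.1 0 uw.2 (Sum.inr a) (Sum.inl β))) :=
    fun a y s => by rw [face_weight_periodic Lc a y s]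
  rw [sum_box_leftFamily_slotPsiS_eq (μ := μ) (γ := α) hLc hrb sf sm j r (locStencil_smul cE (locStencil_wilsonA (d := d) zero_le_one)) one_pos
    (fun κ u t => E_zero_translate (Lc := Lc) cE κ u t) hAb hAp]
  exact sum_box_leftFamily_face_eq_zero hLc hrb sf sm cE j μ α _

/-- NOT IN PRINT; OUR BOOKKEEPING ([folklore]; (27) AT THE COMB DATA, THE SWAP WORD, ZERO MODE; the border's multiplier SECOND legs coarse).
`Σ_{c ∈ box Lc} Σ'_{u′} Σ'_{(y,w)} 𝟙f(y_α)𝟙f(w_β)·((vertexOfK X̃♮_j Lc (unitS (𝒯S′)) ν u′ ∘ X̃♮_j) ∘ vertexOfK X̃♮_j Lc (unitS (𝒯(cE•wilsonA))) μ c) y w (inl α)(inl β) = 0` — per bond A1 (outer legs drop),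
then TRANSPOSITION (leaf-04's route: `tsum_twoFace_eq_trK`, `trK_comp`; the slot-transported Wilson vertex is leg-antisymmetric — A1 `trK_vertexOfK_unitS_slotPsiS`; the sandwich is `sgnK`-symmetric with
`sgnK (Ψ̂X̃Ψ̂ᵀ) = Ψ̂ (sgnK X̃) Ψ̂ᵀ` — A1 `trK_sandwich_dressedStep ∕ sgnK_sandwich`), leaf-04 `tsum_ffLeft_profile_right_word_eq` with the NEGATED charges (D1 `hasSum_sandwich_sgnK_dressedStep_fm_col`) and the
transposed slot `trK ∘` (border vertex over `unitS (slotPsiS S′)`), its first-leg-weighted resummed current untransported (D1 §2), `sum_neg_fmCharge_mul`, D1 §3 and leaf-04's flatness kill with the left face `β`. -/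
theorem sum_box_transported_border_wilson_swap_word_eq_zero (hLc : 1 ≤ Lc) (hrb : rb ∈ box (d + 1) Lc) (hr : r ∈ box (d + 1) Lc) (sf sm cE : ℝ) (j : ℕ)
    (hS' : LocStencil S' Cs δs) (hδs : 0 < δs) (hS'ff : ∀ (κ' : Fin (d + 1)) (t x z : Site (d + 1)) (α' a : Fin (d + 1)), S' κ' t x z (Sum.inl α') (Sum.inl a) = 0)
    (hS'cov : ∀ (κ : Fin (d + 1)) (u t : Site (d + 1)), S' κ (u + (Lc : ℤ) • t) = shiftK (-((Lc : ℤ) • t)) (S' κ u))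
    (hS'supp : ∀ (κ : Fin (d + 1)) (t z w : Site (d + 1)) (a : Fib d) (m : Fin (d + 1)), off Lc w ≠ 0 → S' κ t z w a (Sum.inr m) = 0) :
    ∑ c ∈ box (d + 1) Lc, ∑' u' : Site (d + 1), ∑' yw : Site (d + 1) × Site (d + 1), (if yw.1 α % (Lc : ℤ) = (Lc : ℤ) - 1 then (1 : ℝ) else 0) * (if yw.2 β % (Lc : ℤ) = (Lc : ℤ) - 1 then (1 : ℝ) else 0) *
        comp (comp (vertexOfK (unitK sf sm (coDressKBmAt (toSite rb) Lc (KInvStep (d := d) Lc j))) Lc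
            (unitS sf sm (fun κ u => comp (comp (trK (psiKS r Lc)) (slotPsiS r Lc S' κ u)) (psiKS r Lc))) ν u')
          (unitK sf sm (coDressKBmAt (toSite rb) Lc (KInvStep (d := d) Lc j))))
          (vertexOfK (unitK sf sm (coDressKBmAt (toSite rb) Lc (KInvStep (d := d) Lc j))) Lc
            (unitS sf sm (fun κ u => comp (comp (trK (psiKS r Lc)) (slotPsiS r Lc (fun κ v => cE • wilsonA d κ v) κ u)) (psiKS r Lc))) μ (toSite c)) yw.1 yw.2 (Sum.inl α) (Sum.inl β) = 0 := by
  classical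
  have hLc0 : 0 < Lc := hLc
  set X := unitK sf sm (coDressKBmAt (toSite rb) Lc (KInvStep (d := d) Lc j)) with hX
  set P' := vertexOfK X Lc (unitS sf sm (slotPsiS r Lc (fun κ v => cE • wilsonA d κ v))) μ with hP'def
  set R' := vertexOfK X Lc (unitS sf sm (slotPsiS r Lc S')) ν with hR'def
  -- common-rate data
  obtain ⟨δK, CK, hδK, hCK, hXd⟩ := decays_coDressKBmAt hLc hrb (decays_KInvStep (d := d) (Lc := Lc) j)
  have hXu : Decays X (max |sf| |sm| * CK * max |sf| |sm|) δK := decays_unitK (sf := sf) (sm := sm) hXd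
  have hCX : 0 ≤ max |sf| |sm| * CK * max |sf| |sm| := by positivity
  have hCs : 0 ≤ Cs := (hS' 0 0).nonneg (Sum.inl 0)
  set δ₁ : ℝ := min δK δs with hδ₁
  have hδ₁0 : 0 < δ₁ := lt_min hδK hδs
  have hX1 : Decays X (max |sf| |sm| * CK * max |sf| |sm|) δ₁ := decays_mono hXu hCX le_rfl (min_le_left _ _)
  have hXspr : Spr X := ⟨_, _, hδ₁0, hX1⟩
  have hW1 := locStencil_smul cE (locStencil_wilsonA (d := d) hδ₁0.le)
  have hS1 : LocStencil S' Cs δ₁ := fun κ' u => biLoc_mono (hS' κ' u) hCs (min_le_right _ _)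
  have hWs := locStencil_slotPsiS (d := d) hLc0 r hW1 hδ₁0.le
  have hSs := locStencil_slotPsiS (d := d) hLc0 r hS1 hδ₁0.le
  have hPf := vertexFamily_vertexOfK (N := Lc) hX1 hCX (locStencil_unitS (sf := sf) (sm := sm) hWs) hδ₁0 le_rfl
  have hQf := vertexFamily_vertexOfK (N := Lc) hX1 hCX (locStencil_unitS (sf := sf) (sm := sm) hSs) hδ₁0 le_rfl
  have hCp := (hPf μ 0).nonneg (Sum.inl 0)
  have hCq := (hQf μ 0).nonneg (Sum.inl 0)
  have h₁ : ∀ y : Site (d + 1), |(if y α % (Lc : ℤ) = (Lc : ℤ) - 1 then (1 : ℝ) else 0)| ≤ 1 := fun y => by split_ifs <;> simp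
  have h₂ : ∀ w : Site (d + 1), |(if w β % (Lc : ℤ) = (Lc : ℤ) - 1 then (1 : ℝ) else 0)| ≤ 1 := fun w => by split_ifs <;> simp
  have hSscov : ∀ (κ : Fin (d + 1)) (u t : Site (d + 1)), slotPsiS r Lc S' κ (u + (Lc : ℤ) • t) = shiftK (-((Lc : ℤ) • t)) (slotPsiS r Lc S' κ u) :=
    fun κ u t => slotPsiS_shift hLc0 r hS'cov κ u t
  -- the transposed middle kernel: `trK (Ψ̂XΨ̂ᵀ) = Ψ̂ (sgnK X) Ψ̂ᵀ`
  have hYt : trK (comp (comp (psiKS r Lc) X) (trK (psiKS r Lc))) = comp (comp (psiKS r Lc) (sgnK X)) (trK (psiKS r Lc)) := by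
    rw [hX, trK_sandwich_dressedStep hLc0 hr hLc hrb sf sm j, sgnK_sandwich]
  obtain ⟨CY, hCY, hY⟩ := exists_decays_sandwich hLc0 hr (decays_sgnK hX1) hδ₁0
  have hPt : ∀ c : Site (d + 1), trK (P' c) = -P' c := fun c =>
    trK_vertexOfK_unitS_slotPsiS r Lc X Lc sf sm (fun κ' u x z a b => wilson_antisymm (d := d) cE κ' u x z a b) μ c
  have hTP : ∀ c : Site (d + 1), Tame (P' c) := fun c => Loc.tame ⟨_, _, _, _, half_pos hδ₁0, hPf μ c⟩
  have hTY : Tame (comp (comp (psiKS r Lc) (sgnK X)) (trK (psiKS r Lc))) := (spr_sandwich hLc0 hr ⟨_, _, hδ₁0, decays_sgnK hX1⟩).tame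
  have hTR : ∀ u' : Site (d + 1), Tame (trK (R' u')) := fun u' => Loc.tame ⟨_, _, _, _, half_pos hδ₁0, biLoc_trK (hQf ν u')⟩
  -- per cell bond
  have hval : ∀ c : Site (d + 1), (∑' u' : Site (d + 1), ∑' yw : Site (d + 1) × Site (d + 1), (if yw.1 α % (Lc : ℤ) = (Lc : ℤ) - 1 then (1 : ℝ) else 0) * (if yw.2 β % (Lc : ℤ) = (Lc : ℤ) - 1 then (1 : ℝ) else 0) *
        comp (comp (vertexOfK X Lc (unitS sf sm (fun κ u => comp (comp (trK (psiKS r Lc)) (slotPsiS r Lc S' κ u)) (psiKS r Lc))) ν u') X)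
          (vertexOfK X Lc (unitS sf sm (fun κ u => comp (comp (trK (psiKS r Lc)) (slotPsiS r Lc (fun κ v => cE • wilsonA d κ v) κ u)) (psiKS r Lc))) μ c) yw.1 yw.2 (Sum.inl α) (Sum.inl β)) =
      -∑' y₁ : Site (d + 1), ∑ a : Fin (d + 1), (∑' y : Site (d + 1), (if y β % (Lc : ℤ) = (Lc : ℤ) - 1 then (1 : ℝ) else 0) * P' c y y₁ (Sum.inl β) (Sum.inl a)) *
        ((if y₁ a % (Lc : ℤ) = (Lc : ℤ) - 1 then (1 : ℝ) else 0) * (-(((Lc : ℝ) * (sm * sf)) * ((((Lc ^ (j + 1) : ℕ) : ℝ)) ^ (d + 1 + 1))⁻¹ *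
          (∑' uw : Site (d + 1) × Site (d + 1), (if uw.2 α % (Lc : ℤ) = (Lc : ℤ) - 1 then (1 : ℝ) else 0) * vertexOfK X Lc (unitS sf sm S') ν uw.1 uw.2 0 (Sum.inl α) (Sum.inr a))))) := by
    intro c
    -- (i) transports out, outer legs drop; (ii) transposition
    have e : ∀ u' : Site (d + 1), (∑' yw : Site (d + 1) × Site (d + 1), (if yw.1 α % (Lc : ℤ) = (Lc : ℤ) - 1 then (1 : ℝ) else 0) * (if yw.2 β % (Lc : ℤ) = (Lc : ℤ) - 1 then (1 : ℝ) else 0) *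
          comp (comp (vertexOfK X Lc (unitS sf sm (fun κ u => comp (comp (trK (psiKS r Lc)) (slotPsiS r Lc S' κ u)) (psiKS r Lc))) ν u') X)
            (vertexOfK X Lc (unitS sf sm (fun κ u => comp (comp (trK (psiKS r Lc)) (slotPsiS r Lc (fun κ v => cE • wilsonA d κ v) κ u)) (psiKS r Lc))) μ c) yw.1 yw.2 (Sum.inl α) (Sum.inl β)) =
        -∑' wy : Site (d + 1) × Site (d + 1), (if wy.1 β % (Lc : ℤ) = (Lc : ℤ) - 1 then (1 : ℝ) else 0) * (if wy.2 α % (Lc : ℤ) = (Lc : ℤ) - 1 then (1 : ℝ) else 0) *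
          comp (comp (P' c) (comp (comp (psiKS r Lc) (sgnK X)) (trK (psiKS r Lc)))) (trK (R' u')) wy.1 wy.2 (Sum.inl β) (Sum.inl α) := by
      intro u'
      rw [vertexOfK_unitS_transport_eq_conj hLc0 hr hXspr sf sm hS1 hδ₁0 ν u', vertexOfK_unitS_transport_eq_conj hLc0 hr hXspr sf sm hW1 hδ₁0 μ c,
        tsum_twoFace_conj_word_eq hLc0 hr (hQf ν u') (half_pos hδ₁0) (hPf μ c) (half_pos hδ₁0) hX1 hδ₁0 h₁ (fun y s => face_weight_periodic Lc α y s) h₂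
          (fun w s => face_weight_periodic Lc β w s) _ _]
      refine (tsum_twoFace_eq_trK (comp (comp (R' u') (comp (comp (psiKS r Lc) X) (trK (psiKS r Lc)))) (P' c)) (fun y : Site (d + 1) => (if y α % (Lc : ℤ) = (Lc : ℤ) - 1 then (1 : ℝ) else 0))
        (fun w : Site (d + 1) => (if w β % (Lc : ℤ) = (Lc : ℤ) - 1 then (1 : ℝ) else 0)) (Sum.inl α) (Sum.inl β)).trans ?_
      rw [trK_comp, trK_comp, hYt, hPt c, comp_neg_left, comp_assoc_tame (hTP c) hTY (hTR u'), ← tsum_neg]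
      exact tsum_congr fun wy => by simp only [Pi.neg_apply]; ring
    rw [tsum_congr e, tsum_neg]
    congr 1
    -- (iii) leaf-04's reduction with the negated charges and the transposed slot
    have hP8 : BiLoc (P' c) ((Lc : ℤ) • c) ((Lc : ℤ) • c) _ (δ₁ / 8) := biLoc_mono (hPf μ c) hCp (by linarith)
    have hA := biLoc_comp_right (biLoc_mono (hPf μ c) hCp (show δ₁ / 4 ≤ δ₁ / 2 by linarith)) hY (show (0 : ℝ) ≤ δ₁ / 8 by positivity) (by linarith)
    rw [tsum_ffLeft_profile_right_word_eq (N := Lc) (α := β) (β := α) (Q := fun u' => trK (R' u'))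
      (ρ₁ := fun w : Site (d + 1) => (if w β % (Lc : ℤ) = (Lc : ℤ) - 1 then (1 : ℝ) else 0))
      (ρ₂ := fun y : Site (d + 1) => (if y α % (Lc : ℤ) = (Lc : ℤ) - 1 then (1 : ℝ) else 0)) (show (0 : ℝ) < δ₁ / 8 by positivity) hP8
      (fun y z α' m => by rw [hP'def]; exact vertexOfK_unitS_slotPsiS_entry_eq_zero r X Lc sf sm (fun κ t x z' => wilson_inl_inr cE κ t x z' α' m) μ c y z)
      (decays_mono hY hCY le_rfl (by linarith))
      (fun y₁ a m => by rw [hX]; exact hasSum_sandwich_sgnK_dressedStep_fm_col hLc0 hr hLc hrb sf sm j y₁ a m) hA (fun u => biLoc_trK (biLoc_mono (hQf ν u) hCq (by linarith)))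
      (fun u s => by show trK (R' (u + s)) = _; rw [hR'def, hX, borderSlot_translate (r := rb) hLc sf sm j hSscov ν u s]; rfl)
      (fun u z w b' b => by rw [trK_apply]; exact vertexOfK_unitS_slotPsiS_entry_eq_zero r X Lc sf sm (fun κ t x z' => hS'ff κ t x z' b b') ν u w z)
      (fun u z w m b hz => by rw [trK_apply]; exact borderSlot_inr_snd_eq_zero X sf sm (slotPsiS_inr_snd_supp (Lc := Lc) r hS'supp) ν u w z b m hz) h₂ h₁
      (fun w s => face_weight_periodic Lc α w s)]
    refine tsum_congr fun y₁ => Finset.sum_congr rfl fun a _ => ?_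
    congr 1
    -- (iv) the first-leg-weighted resummed multiplier current of the slot-transported border is the untransported one
    have et : ∀ m : Fin (d + 1), (∑' uw : Site (d + 1) × Site (d + 1), (if uw.2 α % (Lc : ℤ) = (Lc : ℤ) - 1 then (1 : ℝ) else 0) * trK (R' uw.1) 0 uw.2 (Sum.inr m) (Sum.inl α))
        = ∑' uw : Site (d + 1) × Site (d + 1), (if uw.2 α % (Lc : ℤ) = (Lc : ℤ) - 1 then (1 : ℝ) else 0) * vertexOfK X Lc (unitS sf sm S') ν uw.1 uw.2 0 (Sum.inl α) (Sum.inr m) := by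
      intro m
      simp only [trK_apply, hR'def]
      rw [hX]
      exact tsum_prod_weight_fst_vertexOfK_dressedStep_slotPsiS hLc hrb sf sm j ν r hS' hδs h₁ 0 (Sum.inl α) (Sum.inr m)
    simp only [et]
    exact sum_neg_fmCharge_mul (d := d) Lc sf sm (((((Lc ^ (j + 1) : ℕ) : ℝ)) ^ (d + 1 + 1))⁻¹)
      (fun m => ∑' uw : Site (d + 1) × Site (d + 1), (if uw.2 α % (Lc : ℤ) = (Lc : ℤ) - 1 then (1 : ℝ) else 0) * vertexOfK X Lc (unitS sf sm S') ν uw.1 uw.2 0 (Sum.inl α) (Sum.inr m)) y₁ a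
  simp only [hP'def, hX] at hval
  rw [Finset.sum_congr rfl fun c _ => hval (toSite c), Finset.sum_neg_distrib, neg_eq_zero]
  -- (v) the cell sum
  have hAb : ∀ (a : Fin (d + 1)) (y : Site (d + 1)), |(if y a % (Lc : ℤ) = (Lc : ℤ) - 1 then (1 : ℝ) else 0) * (-(((Lc : ℝ) * (sm * sf)) * ((((Lc ^ (j + 1) : ℕ) : ℝ)) ^ (d + 1 + 1))⁻¹ *
      (∑' uw : Site (d + 1) × Site (d + 1), (if uw.2 α % (Lc : ℤ) = (Lc : ℤ) - 1 then (1 : ℝ) else 0) *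
        vertexOfK (unitK sf sm (coDressKBmAt (toSite rb) Lc (KInvStep (d := d) Lc j))) Lc (unitS sf sm S') ν uw.1 uw.2 0 (Sum.inl α) (Sum.inr a))))| ≤
      ∑ a' : Fin (d + 1), |-(((Lc : ℝ) * (sm * sf)) * ((((Lc ^ (j + 1) : ℕ) : ℝ)) ^ (d + 1 + 1))⁻¹ *
        (∑' uw : Site (d + 1) × Site (d + 1), (if uw.2 α % (Lc : ℤ) = (Lc : ℤ) - 1 then (1 : ℝ) else 0) *
          vertexOfK (unitK sf sm (coDressKBmAt (toSite rb) Lc (KInvStep (d := d) Lc j))) Lc (unitS sf sm S') ν uw.1 uw.2 0 (Sum.inl α) (Sum.inr a')))| := by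
    intro a y
    have h1 : |(if y a % (Lc : ℤ) = (Lc : ℤ) - 1 then (1 : ℝ) else 0) * (-(((Lc : ℝ) * (sm * sf)) * ((((Lc ^ (j + 1) : ℕ) : ℝ)) ^ (d + 1 + 1))⁻¹ *
        (∑' uw : Site (d + 1) × Site (d + 1), (if uw.2 α % (Lc : ℤ) = (Lc : ℤ) - 1 then (1 : ℝ) else 0) *
          vertexOfK (unitK sf sm (coDressKBmAt (toSite rb) Lc (KInvStep (d := d) Lc j))) Lc (unitS sf sm S') ν uw.1 uw.2 0 (Sum.inl α) (Sum.inr a))))| ≤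
        |-(((Lc : ℝ) * (sm * sf)) * ((((Lc ^ (j + 1) : ℕ) : ℝ)) ^ (d + 1 + 1))⁻¹ *
          (∑' uw : Site (d + 1) × Site (d + 1), (if uw.2 α % (Lc : ℤ) = (Lc : ℤ) - 1 then (1 : ℝ) else 0) *
            vertexOfK (unitK sf sm (coDressKBmAt (toSite rb) Lc (KInvStep (d := d) Lc j))) Lc (unitS sf sm S') ν uw.1 uw.2 0 (Sum.inl α) (Sum.inr a)))| := by
      rw [abs_mul]; exact mul_le_of_le_one_left (abs_nonneg _) (by split_ifs <;> simp)
    exact h1.trans (Finset.single_le_sum (f := fun a' => |-(((Lc : ℝ) * (sm * sf)) * ((((Lc ^ (j + 1) : ℕ) : ℝ)) ^ (d + 1 + 1))⁻¹ *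
        (∑' uw : Site (d + 1) × Site (d + 1), (if uw.2 α % (Lc : ℤ) = (Lc : ℤ) - 1 then (1 : ℝ) else 0) *
          vertexOfK (unitK sf sm (coDressKBmAt (toSite rb) Lc (KInvStep (d := d) Lc j))) Lc (unitS sf sm S') ν uw.1 uw.2 0 (Sum.inl α) (Sum.inr a')))|)
      (fun _ _ => abs_nonneg _) (Finset.mem_univ a))
  have hAp : ∀ (a : Fin (d + 1)) (y s : Site (d + 1)), (if (y + (Lc : ℤ) • s) a % (Lc : ℤ) = (Lc : ℤ) - 1 then (1 : ℝ) else 0) * (-(((Lc : ℝ) * (sm * sf)) * ((((Lc ^ (j + 1) : ℕ) : ℝ)) ^ (d + 1 + 1))⁻¹ *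
      (∑' uw : Site (d + 1) × Site (d + 1), (if uw.2 α % (Lc : ℤ) = (Lc : ℤ) - 1 then (1 : ℝ) else 0) *
        vertexOfK (unitK sf sm (coDressKBmAt (toSite rb) Lc (KInvStep (d := d) Lc j))) Lc (unitS sf sm S') ν uw.1 uw.2 0 (Sum.inl α) (Sum.inr a)))) =
      (if y a % (Lc : ℤ) = (Lc : ℤ) - 1 then (1 : ℝ) else 0) * (-(((Lc : ℝ) * (sm * sf)) * ((((Lc ^ (j + 1) : ℕ) : ℝ)) ^ (d + 1 + 1))⁻¹ *
      (∑' uw : Site (d + 1) × Site (d + 1), (if uw.2 α % (Lc : ℤ) = (Lc : ℤ) - 1 then (1 : ℝ) else 0) *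
        vertexOfK (unitK sf sm (coDressKBmAt (toSite rb) Lc (KInvStep (d := d) Lc j))) Lc (unitS sf sm S') ν uw.1 uw.2 0 (Sum.inl α) (Sum.inr a)))) :=
    fun a y s => by rw [face_weight_periodic Lc a y s]
  rw [sum_box_leftFamily_slotPsiS_eq (μ := μ) (γ := β) hLc hrb sf sm j r (locStencil_smul cE (locStencil_wilsonA (d := d) zero_le_one)) one_pos
    (fun κ u t => E_zero_translate (Lc := Lc) cE κ u t) hAb hAp]
  exact sum_box_leftFamily_face_eq_zero hLc hrb sf sm cE j μ β _

end Words

/-! ## §3 At the comb data: an1's sym border, every kernel level -/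

section Comb

variable {μ ν α β : Fin (d + 1)}

/-- NOT IN PRINT; OUR BOOKKEEPING ([folklore]; (27)_comb AT an1's RECORD).  At the comb root `ρ_c = ctr (d+1) Lc` (`= toSite (ctrOff (d+1) Lc)`, `rfl`), transport `𝒯 = Ψ̂_Sᵀ∘slotPsiS (ctrOff) Lc∘Ψ̂_S`,
every kernel level `j`, all units, any `cE`, any border weight `c` (an1's border `S^VH_c = c • symVhSAt ρ_c`: local, no ff block, block-covariant, multiplier legs on the coarse lattice — F3's sockets),
all axes: `Σ_{cb ∈ box Lc} Σ'_{u′} FF[(vertexOfK X̃_j Lc (unitS (𝒯(cE•wilsonA))) μ cb ∘ X̃_j) ∘ vertexOfK X̃_j Lc (unitS (𝒯 S^VH_c)) ν u′] = 0` AND the swap — §2 at `r = rb = ctrOff (d+1) Lc`.  At `j = 0`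
these are the `E′ ⊗ VH′` words of 33_0 at the comb data (F6 `dM_comb_zero_split`, `c = cVH`). -/
theorem sum_box_comb_wilson_symVhS_words_eq_zero (sf sm cE c : ℝ) (j : ℕ) :
    (∑ cb ∈ box (d + 1) Lc, ∑' u' : Site (d + 1), ∑' yw : Site (d + 1) × Site (d + 1),
        (if yw.1 α % (Lc : ℤ) = (Lc : ℤ) - 1 then (1 : ℝ) else 0) * (if yw.2 β % (Lc : ℤ) = (Lc : ℤ) - 1 then (1 : ℝ) else 0) *
        comp (comp (vertexOfK (unitK sf sm (coDressKBmAt (ctr (d + 1) Lc) Lc (KInvStep (d := d) Lc j))) Lc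
            (unitS sf sm (fun κ v => comp (comp (trK (psiKS (ctrOff (d + 1) Lc) Lc))
              (slotPsiS (ctrOff (d + 1) Lc) Lc (fun κ v => cE • wilsonA d κ v) κ v)) (psiKS (ctrOff (d + 1) Lc) Lc))) μ (toSite cb))
          (unitK sf sm (coDressKBmAt (ctr (d + 1) Lc) Lc (KInvStep (d := d) Lc j))))
          (vertexOfK (unitK sf sm (coDressKBmAt (ctr (d + 1) Lc) Lc (KInvStep (d := d) Lc j))) Lc
            (unitS sf sm (fun κ v => comp (comp (trK (psiKS (ctrOff (d + 1) Lc) Lc))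
              (slotPsiS (ctrOff (d + 1) Lc) Lc (fun κ v => c • symVhSAt (ctr (d + 1) Lc) d Lc rfl κ v) κ v)) (psiKS (ctrOff (d + 1) Lc) Lc))) ν u')
          yw.1 yw.2 (Sum.inl α) (Sum.inl β) = 0) ∧
    (∑ cb ∈ box (d + 1) Lc, ∑' u' : Site (d + 1), ∑' yw : Site (d + 1) × Site (d + 1),
        (if yw.1 α % (Lc : ℤ) = (Lc : ℤ) - 1 then (1 : ℝ) else 0) * (if yw.2 β % (Lc : ℤ) = (Lc : ℤ) - 1 then (1 : ℝ) else 0) *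
        comp (comp (vertexOfK (unitK sf sm (coDressKBmAt (ctr (d + 1) Lc) Lc (KInvStep (d := d) Lc j))) Lc
            (unitS sf sm (fun κ v => comp (comp (trK (psiKS (ctrOff (d + 1) Lc) Lc))
              (slotPsiS (ctrOff (d + 1) Lc) Lc (fun κ v => c • symVhSAt (ctr (d + 1) Lc) d Lc rfl κ v) κ v)) (psiKS (ctrOff (d + 1) Lc) Lc))) ν u')
          (unitK sf sm (coDressKBmAt (ctr (d + 1) Lc) Lc (KInvStep (d := d) Lc j))))
          (vertexOfK (unitK sf sm (coDressKBmAt (ctr (d + 1) Lc) Lc (KInvStep (d := d) Lc j))) Lc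
            (unitS sf sm (fun κ v => comp (comp (trK (psiKS (ctrOff (d + 1) Lc) Lc))
              (slotPsiS (ctrOff (d + 1) Lc) Lc (fun κ v => cE • wilsonA d κ v) κ v)) (psiKS (ctrOff (d + 1) Lc) Lc))) μ (toSite cb))
          yw.1 yw.2 (Sum.inl α) (Sum.inl β) = 0) := by
  have hLc : 1 ≤ Lc := Nat.one_le_iff_ne_zero.mpr (NeZero.ne Lc)
  exact ⟨sum_box_transported_wilson_border_word_eq_zero (μ := μ) (ν := ν) (α := α) (β := β) hLc (ctrOff_mem_box (pos_Lc (Lc := Lc))) (ctrOff_mem_box (pos_Lc (Lc := Lc))) sf sm cE j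
      (locStencil_symVhS (Lc := Lc) c zero_le_one) one_pos (fun κ' t x z α' a => symVhS_inl_inl (Lc := Lc) c κ' t x z α' a) (fun κ u t => symVhS_translate hLc c κ u t)
      (fun κ t z w m b hz => symVhS_inr_fst_eq_zero (Lc := Lc) c κ t z w m b hz),
    sum_box_transported_border_wilson_swap_word_eq_zero (μ := μ) (ν := ν) (α := α) (β := β) hLc (ctrOff_mem_box (pos_Lc (Lc := Lc))) (ctrOff_mem_box (pos_Lc (Lc := Lc))) sf sm cE j
      (locStencil_symVhS (Lc := Lc) c zero_le_one) one_pos (fun κ' t x z α' a => symVhS_inl_inl (Lc := Lc) c κ' t x z α' a) (fun κ u t => symVhS_translate hLc c κ u t)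
      (fun κ t z w a m hw => symVhS_inr_snd_eq_zero (Lc := Lc) c κ t z w a m hw)⟩

end Comb

end Summit.QuantumFields.BalabanUV.Beta.GAN24.CombBorderWordsZero

end
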